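import Mathlib
import Summits.CriticalPhenomena.CardyFormulaZ2.Theorems.CardyMagicRigidityDefs
import Summits.CriticalPhenomena.CardyFormulaZ2.Theorems.CardyMagicRigidityNestingRigidityLatticeDustZ2Scales
import Summits.CriticalPhenomena.CardyFormulaZ2.Theorems.CardyMagicRigidityNestingRigidityBondTranslation
import Summits.CriticalPhenomena.CardyFormulaZ2.Theorems.CardyMagicRigidityNestingRigidityBondDuality
import Literature.Probability.Percolation.BoxCrossingUpperBound
import HarnessLib

/-!
# Lattice dust density (Dlat), bond-`ℤ²` half: mesoscopic loops of both types are dense in `zEns`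

Crux `Summit.CriticalPhenomena.CardyFormulaZ2.Theses.CardyMagicRigidity.NestingRigidity`
(stmt-CriticalPhenomena-4835), line `positive-cone-weight-doubling`, toward the registered stub
`latticeDust_latticeEnsembles`.  This brick turns the RSW input about the origin
(`latticeDust_bond_origin`, …LatticeDustZ2Scales: off an event of probability `≤ (1 - p₀)^K`, a type-`1`
member of `bondLoopConfig δ 0 ω` of diameter `≥ a₀δ/2` inside `B(0, 20 a₀ 16^K δ)`) into the LOCAL dust
density of `zEns` at every centre and for BOTH types (registered anchor `latticeDust_local_zEns`, the
bond twin of `latticeDust_local_tEns`):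

* translation (`bondLoopConfig_relabel_shift`, `measurePreserving_relabel_shift_zEns`, …BondTranslation):
  the event about the lattice point nearest to `y/δ` has the same probability and its loops are the
  translated loops;
* duality (`mem_bondLoopConfig_dualConfig_iff`, …BondDuality; `bondPercolation_map_dualConfig_holds`):
  a type-`1` member of the loop representation of `dualConfig ω` is, shifted by `δ(1+i)/2` and reversed,
  a type-`0` member of that of `ω`, and `ω ↦ dualConfig ω` preserves `P_{1/2}`
  (`bondPercolation_half_real_preimage_dualConfig`).
-/

noncomputable section

open MeasureTheory Set Filter Metric TopologicalSpace Function
open scoped Topology ENNReal NNReal unitInterval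

namespace Summit.CriticalPhenomena.CardyFormulaZ2.Cruxes.NestingRigidity.PositiveConeWeightDoubling

open Literature.Probability.RandomPlanarGeometry Literature.Probability.Percolation
  Literature.Probability.LatticeModels
open Summit.CriticalPhenomena.CardyFormulaZ2.Cruxes.NestingRigidity.RingCloudTomography
open Summit.CriticalPhenomena.CardyFormulaZ2.Cruxes.NestingRigidity.RingCloudTomography.BondTranslation
  (measurePreserving_relabel_shift_zEns dualConfig_relabel_shift_eq shift_mem_edgeSet_iff)
open Summit.CriticalPhenomena.CardyFormulaZ2.Cruxes.NestingRigidity.MarkovCascadeOneGeneration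
  (mem_bondLoopConfig_dualConfig_iff continuous_translate isometry_translate)

/-! ## §1 Deterministic transfers: translation and duality -/

/-- Translations of the plane preserve diameters (bookkeeping for the bundled continuous map). -/
theorem latticeDust_diam_image_translate (b : ℂ) (s : Set ℂ) :
    diam ((⟨fun z : ℂ ↦ 1 * z + b, continuous_translate b⟩ : C(ℂ, ℂ)) '' s) = diam s :=
  (isometry_translate b).diam_image s

/-- **Translation transfer.**  A member of type `i` of the loop representation of the configuration
translated by `-c` with trace in `B(0, R')` comes from a member of type `i` of the loop representation of
`ω` with trace in `B(δc, R')` and the same diameter (`bondLoopConfig_relabel_shift`). -/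
theorem latticeDust_of_relabel_shift {δ : ℝ} {c : Site 2} {ω : BondConfig (Site 2)} {i : Fin 2}
    {R' D : ℝ}
    (h : ∃ u ∈ (bondLoopConfig δ 0 (BondConfig.relabel (sym2Equiv (Site.shift (-c))) ω)).F i,
      u.range ⊆ ball (0 : ℂ) R' ∧ D ≤ 2 * diam u.range) :
    ∃ v ∈ (bondLoopConfig δ 0 ω).F i, v.range ⊆ ball (meshPoint δ c) R' ∧ D ≤ 2 * diam v.range := by
  obtain ⟨u, hu, hur, hud⟩ := h
  rw [bondLoopConfig_relabel_shift, LoopConfig.mem_map_iff] at hu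
  obtain ⟨v, hv, rfl⟩ := hu
  rw [UnbasedLoop.range_map] at hur hud
  rw [latticeDust_diam_image_translate] at hud
  refine ⟨v, hv, fun z hz ↦ ?_, hud⟩
  have hz' := hur ⟨z, hz, rfl⟩
  rw [mem_ball, dist_zero_right] at hz'
  have heq : (⟨fun z : ℂ ↦ 1 * z + meshPoint δ (-c), continuous_translate _⟩ : C(ℂ, ℂ)) z =
      z - meshPoint δ c := by
    show 1 * z + meshPoint δ (-c) = z - meshPoint δ c
    rw [one_mul, sub_eq_add_neg]
    congr 1
    apply Complex.ext <;> simp [meshPoint_re, meshPoint_im]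
  rw [mem_ball, dist_eq_norm]
  rwa [heq] at hz'

/-- **Duality transfer.**  For a lattice configuration `ξ`, a member of type `1` of the loop
representation of `dualConfig ξ` with trace in `B(0, R')` yields a member of type `0` of the loop
representation of `ξ` with trace in `B(0, R' + δ)` and the same diameter (shift by `δ(1+i)/2` and
reversal, `mem_bondLoopConfig_dualConfig_iff`). -/
theorem latticeDust_typeZero_of_dualConfig {δ : ℝ} (hδ : 0 < δ) {ξ : BondConfig (Site 2)}
    (hξ : ξ ⊆ (zdGraph 2).edgeSet) {R' D : ℝ}
    (h : ∃ u ∈ (bondLoopConfig δ 0 (dualConfig ξ)).F 1, u.range ⊆ ball (0 : ℂ) R' ∧ D ≤ 2 * diam u.range) :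
    ∃ v ∈ (bondLoopConfig δ 0 ξ).F 0, v.range ⊆ ball (0 : ℂ) (R' + δ) ∧ D ≤ 2 * diam v.range := by
  obtain ⟨u, hu, hur, hud⟩ := h
  have hmem := (mem_bondLoopConfig_dualConfig_iff δ ξ hξ 1 u).1 hu
  have h10 : (1 : Fin 2) - 1 = 0 := by decide
  rw [h10] at hmem
  refine ⟨_, hmem, ?_, ?_⟩
  · rw [UnbasedLoop.range_reverse, UnbasedLoop.range_map]
    rintro _ ⟨z, hz, rfl⟩
    have hz' := hur hz
    rw [mem_ball, dist_zero_right] at hz' ⊢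
    simp only [ContinuousMap.coe_mk, one_mul]
    have hshift : ‖(δ : ℂ) * (1 + Complex.I) / 2‖ < δ := by
      rw [norm_div, norm_mul, Complex.norm_real, Real.norm_of_nonneg hδ.le, Complex.norm_two]
      have h2 : ‖(1 : ℂ) + Complex.I‖ < 2 := by
        rw [Complex.norm_def, Complex.normSq_apply]
        simp only [Complex.add_re, Complex.one_re, Complex.I_re, add_zero, Complex.add_im,
          Complex.one_im, Complex.I_im, zero_add, mul_one]
        rw [show (1 : ℝ) + 1 = 2 by norm_num, Real.sqrt_lt' two_pos]
        norm_num
      calc δ * ‖(1 : ℂ) + Complex.I‖ / 2 < δ * 2 / 2 := by gcongr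
        _ = δ := by ring
    calc ‖z + (δ : ℂ) * (1 + Complex.I) / 2‖ ≤ ‖z‖ + ‖(δ : ℂ) * (1 + Complex.I) / 2‖ := norm_add_le _ _
      _ < R' + δ := add_lt_add hz' hshift
  · rwa [UnbasedLoop.range_reverse, UnbasedLoop.range_map, latticeDust_diam_image_translate]

/-! ## §2 Probability: translation and duality preserve `P_{1/2}` -/

/-- The preimage of an event under the lattice translation of configurations has the same probability. -/
theorem latticeDust_real_preimage_relabel_shift (w : Site 2) {B : Set (BondConfig (Site 2))}
    (hB : MeasurableSet B) :
    (bondPercolation (zdGraph 2) half).real (BondConfig.relabel (sym2Equiv (Site.shift w)) ⁻¹' B) =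
      (bondPercolation (zdGraph 2) half).real B := by
  have h := (measurePreserving_relabel_shift_zEns w).measure_preimage hB.nullMeasurableSet
  simp only [measureReal_def]
  exact congrArg ENNReal.toReal h

/-! ## §3 The local dust density of `zEns` -/

/-- **Registered anchor `latticeDust_local_zEns` — lattice dust density of `zEns`, local form.**  For
every `ρ > 0` and `κ > 0` there is `d > 0` such that for all small meshes `δ` and every centre `y`, off
an event of probability `≤ κ`, the disc `B(y, ρ)` contains a member of each type of `zEns.X δ ω` of
diameter `≥ d`.  (The origin input `latticeDust_bond_origin` at base scale `a₀ = ⌈r₁/δ⌉` about the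
lattice point nearest to `y`, for `ω` (type `1`) and for `dualConfig ω` (type `0`), §1–§2.) -/
theorem latticeDust_local_zEns : ∀ (ρ κ : ℝ), 0 < ρ → 0 < κ → ∃ d : ℝ, 0 < d ∧
    ∀ᶠ δ in 𝓝[>] (0 : ℝ), ∀ y : ℂ, ∃ G : Set zEns.Ω, MeasurableSet G ∧ zEns.P Gᶜ ≤ ENNReal.ofReal κ ∧
      ∀ ω ∈ G, ∀ i : Fin 2, ∃ v ∈ (zEns.X δ ω).F i, v.range ⊆ ball y ρ ∧ d ≤ diam v.range := by
  intro ρ κ hρ hκ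
  obtain ⟨p₀, hp₀, hp₁, horig⟩ := latticeDust_bond_origin
  obtain ⟨K, hK⟩ := exists_pow_lt_of_lt_one (half_pos hκ) (show 1 - p₀ < 1 by linarith)
  set A : ℝ := 16 ^ K with hA
  have hA1 : 1 ≤ A := one_le_pow₀ (by norm_num)
  set r₁ : ℝ := ρ / (50 * A) with hr₁
  have hr₁pos : 0 < r₁ := by positivity
  have hr₁A : 20 * A * r₁ = 2 * ρ / 5 := by rw [hr₁]; field_simp; ring
  have hr₁ρ : A * r₁ ≤ ρ / 50 := by rw [hr₁]; field_simp; exact le_rfl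
  refine ⟨r₁ / 2, by positivity, ?_⟩
  have hev : ∀ᶠ δ in 𝓝[>] (0 : ℝ), δ < r₁ := nhdsWithin_le_nhds (Iio_mem_nhds hr₁pos)
  filter_upwards [hev, self_mem_nhdsWithin] with δ hδr hδ y
  rw [mem_Ioi] at hδ
  -- base scale and lattice centre
  set a₀ : ℕ := ⌈r₁ / δ⌉₊ with ha₀
  have ha₀1 : 1 ≤ a₀ := Nat.one_le_iff_ne_zero.2 (Nat.ceil_pos.2 (by positivity)).ne'
  have ha₀r : r₁ ≤ δ * a₀ := by
    rw [ha₀, ← div_le_iff₀' hδ]; exact Nat.le_ceil _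
  have ha₀r' : δ * a₀ ≤ r₁ + δ := by
    have := (Nat.ceil_lt_add_one (show 0 ≤ r₁ / δ by positivity)).le
    rw [ha₀]
    calc δ * (⌈r₁ / δ⌉₊ : ℝ) ≤ δ * (r₁ / δ + 1) := by gcongr
      _ = r₁ + δ := by field_simp
  set c : Site 2 := nearestSite δ y with hc
  have hcy : dist (meshPoint δ c) y ≤ δ := dist_meshPoint_nearestSite_le hδ y
  obtain ⟨B, hBm, hBP, hBdet⟩ := horig a₀ K ha₀1
  -- the good event
  set φ : BondConfig (Site 2) → BondConfig (Site 2) := ⇑(BondConfig.relabel (sym2Equiv (Site.shift (-c)))) with hφ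
  have hφm : Measurable φ := (BondConfig.relabel (sym2Equiv (Site.shift (-c)))).measurable
  set G : Set (BondConfig (Site 2)) :=
    {ω | ω ⊆ (zdGraph 2).edgeSet} ∩ ((φ ⁻¹' B)ᶜ ∩ (dualConfig ⁻¹' (φ ⁻¹' B))ᶜ) with hG
  have hGm : MeasurableSet G := measurableSet_setOf_subset_edgeSet.inter
    ((hφm hBm).compl.inter (measurable_dualConfig (hφm hBm)).compl)
  refine ⟨G, hGm, ?_, ?_⟩
  · -- probability: `P(Gᶜ) ≤ 0 + P(B) + P(B) ≤ 2 (1 - p₀)^K ≤ κ`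
    have h0 : (bondPercolation (zdGraph 2) half).real {ω : BondConfig (Site 2) | ω ⊆ (zdGraph 2).edgeSet}ᶜ = 0 := by
      rw [measureReal_def, ENNReal.toReal_eq_zero_iff]
      exact Or.inl (ae_iff.1 (ae_subset_edgeSet (zdGraph 2) half))
    have h1 : (bondPercolation (zdGraph 2) half).real (φ ⁻¹' B) ≤ (1 - p₀) ^ K := by
      rw [hφ, latticeDust_real_preimage_relabel_shift (-c) hBm]; exact hBP
    have h2 : (bondPercolation (zdGraph 2) half).real (dualConfig ⁻¹' (φ ⁻¹' B)) ≤ (1 - p₀) ^ K := by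
      rw [bondPercolation_half_real_preimage_dualConfig (hφm hBm), hφ, latticeDust_real_preimage_relabel_shift (-c) hBm]
      exact hBP
    have hreal : (bondPercolation (zdGraph 2) half).real Gᶜ ≤ κ := by
      rw [hG, compl_inter, compl_inter, compl_compl, compl_compl]
      calc _ ≤ (bondPercolation (zdGraph 2) half).real {ω : BondConfig (Site 2) | ω ⊆ (zdGraph 2).edgeSet}ᶜ +
            (bondPercolation (zdGraph 2) half).real (φ ⁻¹' B ∪ dualConfig ⁻¹' (φ ⁻¹' B)) :=
            measureReal_union_le _ _
        _ ≤ 0 + ((1 - p₀) ^ K + (1 - p₀) ^ K) := by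
            rw [h0]; exact add_le_add le_rfl ((measureReal_union_le _ _).trans (add_le_add h1 h2))
        _ ≤ κ := by linarith
    change bondPercolation (zdGraph 2) half Gᶜ ≤ ENNReal.ofReal κ
    rw [← ENNReal.ofReal_toReal (measure_ne_top _ _)]
    exact ENNReal.ofReal_le_ofReal hreal
  · -- deterministic consequence
    rintro (ω : BondConfig (Site 2)) ⟨hωE, hωB, hωB'⟩ i
    rw [mem_compl_iff, mem_preimage] at hωB hωB'
    have hφE : φ ω ⊆ (zdGraph 2).edgeSet := by
      intro e he
      rw [hφ, BondConfig.mem_relabel_iff] at he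
      have := hωE he
      rwa [← shift_mem_edgeSet_iff (-c), Equiv.apply_symm_apply] at this
    have hball : ball (meshPoint δ c) (δ * (20 * (a₀ * 16 ^ K)) + δ) ⊆ ball y ρ := by
      intro z hz
      rw [mem_ball] at hz ⊢
      have h20 : δ * (20 * (a₀ * 16 ^ K)) ≤ 2 * ρ / 5 + 20 * A * δ := by
        rw [← hA, show δ * (20 * (a₀ * A)) = 20 * A * (δ * a₀) by ring, ← hr₁A]
        nlinarith
      have hδA : 20 * A * δ + 2 * δ ≤ ρ / 2 := by nlinarith
      calc dist z y ≤ dist z (meshPoint δ c) + dist (meshPoint δ c) y := dist_triangle _ _ _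
        _ < ρ := by linarith
    have hdiam : ∀ v : UnbasedLoop ℂ, δ * a₀ ≤ 2 * diam v.range → r₁ / 2 ≤ diam v.range :=
      fun v hv ↦ by linarith
    fin_cases i
    · -- type `0`: the origin input for `dualConfig (φ ω) = φ (dualConfig ω)`, duality, translation
      have hωB'' : dualConfig (φ ω) ∉ B := by rwa [hφ, dualConfig_relabel_shift_eq]
      have h := hBdet _ hωB'' (fun e he ↦ (mem_dualConfig_iff.1 he).1) δ hδ
      obtain ⟨v, hv, hvr, hvd⟩ := latticeDust_of_relabel_shift (latticeDust_typeZero_of_dualConfig hδ hφE h)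
      exact ⟨v, hv, hvr.trans hball, hdiam v hvd⟩
    · -- type `1`: the origin input for `φ ω`, translation
      have h := hBdet _ hωB hφE δ hδ
      obtain ⟨v, hv, hvr, hvd⟩ := latticeDust_of_relabel_shift (c := c) (i := 1) h
      exact ⟨v, hv, (hvr.trans (ball_subset_ball (by linarith))).trans hball, hdiam v hvd⟩

end Summit.CriticalPhenomena.CardyFormulaZ2.Cruxes.NestingRigidity.PositiveConeWeightDoubling

end
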